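import Mathlib.Analysis.InnerProductSpace.Projection.Basic
import Mathlib.Data.Fin.Tuple.Sort
import Literature.MathematicalPhysics.QuantumLattice.HubbardSchwingerFunction
import Literature.MathematicalPhysics.QuantumLattice.KohnLuttingerFermiCurvePolarIntegral
import Literature.MathematicalPhysics.QuantumLattice.SectorisedKernelNorm
import Literature.Analysis.OperatorTheory.IntegralOperatorHilbertSchmidt
import HarnessLib

/-!
# The Cooper-channel four-point vertex of the 2D Hubbard torus, its `D₄` blocks on `L²` of the
# Fermi curve, and the scale-resolved quartic kernels in isotropic sectors

Topic `Literature/MathematicalPhysics/QuantumLattice`; definition request `defn-HubbardCooperVertexBlocks`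
(D2 of the LADDER-Hubbard Kohn–Luttinger programme, cell `gate-hubbard-kl`, DECOMP §8 / App. E (E1, E4);
wanted by the crux `KLRegimeTwoPointLimit` = stmt-HubbardSuperconductivity-19937 of route `KLProgramme`).
The request: (A) the amputated connected four-point vertex of `hubbardTorusWith 2 L 1 U μ` at inverse
temperature `β` in COOPER kinematics — incoming `(k, -k)`, outgoing `(k', -k')`, spatial momenta on the
free Fermi curve `F_μ` of `squareDispersion 1 0` through the polar parametrisation (`bandFermiRadius`,
`fermiPolar`), external Matsubara frequencies `±π/β` — as a finite-volume kernel in the two angles;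
(B) its `L → ∞` limit as a bounded operator on `L²(F_μ, ds/|∇ε|)` and its `D₄` blocks
`Γ ∈ {A₁g, A₂g, B₁g, B₂g, E}` (the vocabulary of `KohnLuttinger.lean` / `KohnLuttingerChannelStates.lean`);
(C) the SCALE-RESOLVED version: the quartic kernel of the scale-`h` effective action
`hubbardEffectiveActionCT L M β U μ h K Λ` projected to ISOTROPIC angular sectors of width `γ^h`, as an
array over sector 4-tuples, with the particle–particle transfer map of a 4-tuple.  Everything below is a
definition with a body or a PROVED statement; no named fact, no instance, no truth claim about the
Hubbard model (existence of limits, boundedness of kernels and admissibility of sectors are separate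
`Prop`s or junk-guarded).

## Contents

§1 TIME-ORDERED `n`-POINT SCHWINGER FUNCTIONS (finite volume; BGM 2006 (1.2)–(1.3)).  `SchwingerLeg L`
(charge `0 ↦ a† = ψ⁺`, `1 ↦ a = ψ⁻`, torus site, spin, imaginary time); `hubbardFieldOp`,
`schwingerLegOp` (the evolved field, via the tree's `Matrix.imagTimeEvolve`); `timeOrderPerm`
(decreasing times, `Tuple.sort` reversed; `antitone_comp_timeOrderPerm`), `timeOrderedProd` (sign of the
permutation times the ordered product), **`schwingerFn β U μ L ℓ = ⟨T ∏ a^{c_i}_{x⃗_iσ_i}(x₀,ᵢ)⟩_{β,L}`**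
(junk `0` at `L = 0`), **`schwingerFn_two`**: for two legs this IS the tree's `Matrix.schwingerTwoPoint`
(same sign, same equal-time convention), `schwingerFn_annihilation_creation` (= `hubbardSchwingerTwoPoint`
of `HubbardSchwingerFunction.lean`); `schwingerFourT` — the truncated four-point function
`S₄ - (S₂S₂ - S₂S₂ + S₂S₂)`.

§2 MOMENTUM SPACE AND THE COOPER VERTEX.  `MomentumLeg` (charge, spin, `k₀ ∈ ℝ`, `k⃗ ∈ ℝ²`);
`legPhase` = `e^{-is_c(k₀x₀ + k⃗·x⃗)}` (the sign of `hubbardPlaneWave`, BGM (2.5)); `legTransform` —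
`(βL²)⁻¹ ∫_{[0,β]^n} Σ_{x⃗ ∈ Λ_L^n} ∏ phases × S` (one volume factor divided out); `schwingerFnHat`,
`schwingerFourTHat`, `propagatorHat` (the interacting `Ŝ₂(k, σ)`, transform of `⟨T ψ⁻ψ⁺⟩`),
`amputatedFourHat = Ŝ₄ᵀ / ∏ Ŝ₂(k_i)`; `cooperLegs β μ θ θ'` — the four legs
`ψ̂⁺_{p_F(θ')↑}(ω) ψ̂⁻_{p_F(θ)↑}(ω) ψ̂⁺_{-p_F(θ')↓}(-ω) ψ̂⁻_{-p_F(θ)↓}(-ω)`, `ω = π/β`, in the field order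
`ψ⁺_σψ⁻_σψ⁺_{σ'}ψ⁻_{σ'}` of BGM (2.25); **`hubbardCooperVertex β U μ L θ θ'`** (the requested
`cooperVertex β U μ L θ θ'` — that name is already the Grassmann-side coefficient of
`HubbardScaleReport.lean`; junk `0` at `L = 0`).

§3 THE LIMIT, THE OPERATOR ON `L²(F_μ)`, THE BLOCKS.  §3a (generic, complex scalars): for a kernel
`K : X → X → ℂ` on a measure space, `IsBoundedKernelOn ν K` (finite `ν`, jointly measurable bounded `K`)
and **`boundedKernelOp ν K : Lp ℂ 2 ν →L[ℂ] Lp ℂ 2 ν`**, the integral operator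
`(T_Kφ)(x) = ∫ K(x,y)φ(y)dν(y)` (`LinearMap.mkContinuousOfExistsBound` on the `L¹ ≤ L²` estimate, the
complex-scalar version of `Literature.Analysis.OperatorTheory.exists_kernelOp`; junk `0` outside the
class), with `boundedKernelOp_coeFn` (the a.e. kernel formula).  §3b: `hubbardCooperVertexLimit`
(`limUnder atTop`), the existence Prop `HubbardCooperVertexLimitExists`, `momentumArg`,
`hubbardCooperVertexKernel β U μ k⃗' k⃗ = Γ_∞(θ(k⃗), θ(k⃗'))`, **`hubbardCooperVertexOp β U μ`** — the Cooper
vertex as a bounded operator on `L²(fermiCurveMeasure (squareDispersion 1 0) μ)`; `InChannelC`,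
**`channelL2 ε μ χ`** — the closed span in `L²(F_μ)` of the functions transforming in the irrep `χ`
(`isClosed_channelL2`, `completeSpace_channelL2`); **`hubbardCooperVertexBlock β U μ χ`** (the requested
`cooperVertexBlock β U μ Γ`) — the compression `P_χ T P_χ` as a bounded operator on the Hilbert space
`channelL2 … χ`, the shape `E →L[ℂ] E` consumed by the block-Riccati comparison
(`Theorems/KLProgrammeCooperChannelRiccatiFlow*.lean`: `formInf`, `c2OneStep`).

§4 SCALE-RESOLVED KERNELS IN ISOTROPIC SECTORS (BGM 2006 §2.5 (2.57)–(2.58), §2.7 (2.70)–(2.71)).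
`sectorMultiplierGen L M e₀ β e n m` — the two-index (scale `n`, angular index `m`) lattice-momentum sector
multipliers `C_h⁻¹ · ζ_{m,ω}` (`m = n`: `bgmMultiplier`, `sectorMultiplierGen_self`); **`isoMultiplier`**
(`m = 2n`: `sectorCount (2n) = 2·4ⁿ` isotropic sectors of width `π4^{-n}`), `sum_isoMultiplier` (partition
of unity), `norm_isoMultiplier_le_one`; `quarticSectorLegs` (the leg labels of a 4-tuple in the order
(2.25)), `quarticKernelSectors` (= `sectorisedKernel` in degree `4`), **`quarticKernelIsoSectors L M β U μ
h K Λ e₀ n σ σ' Ω̄ x`** — the position-space quartic kernels `λ̃_{h,Ω̄}(x₁,…,x₄)` of the scale-`h` effective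
action with isotropic external sectors (the objects of the sectorised `L¹–L^∞` norms
`hubbardSectorKernelNorm`); `singletCoupling` (the tree's `cooperVertex` read in the order (2.25)),
`sectorWeight4`, `singletCouplingSectors`, **`singletCouplingIsoSectors … n : (Fin (sectorCount (2n)))⁴ → ℂ`**
— the sector-averaged singlet coupling array `V_h(Ω̄)`; the transfer maps `isoSectorFermiPoint`,
`torusReduce`, `reciprocalLatticeDist`, **`ppTransfer`** (`q = p_F(θ̄_{ω̄₂}) + p_F(θ̄_{ω̄₄})`),
`phTransferDirect`, `phTransferExchange`, `transferScale` (`t = min(0,⌊log_γ|q|_𝕋⌋)`, `⊥` at `q = 0`),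
`ppTransferScale`.

## Design choices and what is NOT claimed

* The Hamiltonian-side vertex (§1–§2) is built on the Fock space of the fermionic torus exactly as
  `hubbardThermalTwoPoint` / `hubbardSchwingerTwoPoint` (Gibbs state of `hubbardTorusWith 2 L 1 U μ`,
  `Matrix.gibbsState`, `Matrix.imagTimeEvolve`), for every `n`; the time ordering is the sign-weighted
  sort by decreasing time (among equal times the later leg stands to the left — a null set for the time
  integrals; for `n = 2` it is the tree's convention, `schwingerFn_two`).  Continuum external momenta are
  allowed (Fermi points are not lattice momenta at finite `L`): the spatial phase is read on the
  representatives in `[0, L)`, the one volume factor `βL²` of translation invariance is divided out.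
  No convergence, no bound and no symmetry (`SU(2)`, `D₄`, `k ↔ -k`) of these functions is asserted.
* The limit is `limUnder` (junk without convergence) with the existence `Prop` apart; the operator on
  `L²(F_μ)` is junk `0` unless the limiting kernel is bounded and jointly measurable
  (`IsBoundedKernelOn`), the only regime in which the elementary construction applies — no regularity of
  the limiting vertex is claimed.  The channel spaces are CLOSED SPANS (complete by construction), so the
  blocks are honest bounded operators on Hilbert spaces without any measure-preservation statement for
  the `D₄` action on `μ_F`.
* §4 is finite `(β, L, M)` and purely algebraic over the Grassmann algebra, as `SectorisedKernelNorm` /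
  `HubbardEffectiveActionCT`: the isotropic refinement is the two-index multiplier with angular index
  `2n` (exactly `IsotropicSectors.isotropicCutoff`'s choice `sectorWidth (2n) = π4^{-n}`), on the
  renormalised band `e_K = nambuXiCT L μ K` of the counterterm frame.  The scalar array is the
  multiplier-weighted AVERAGE of the singlet coupling function over the conserving lattice 4-tuples of the
  four sector supports (junk on inadmissible 4-tuples) — at finite `L` the sector centres `p_F(θ̄)` are not
  lattice momenta, so "the value at the sector centres" is not available and the average is the canonical
  finite-volume substitute; the transfer momenta are read at the sector centres on the FREE Fermi curve
  (`fermiPolar μ`), i.e. up to the `O(γ^h)` sector size, as in the programme's memo.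
* Mathlib / tree search: no time-ordered `n`-point function, amputation or Cooper vertex in the tree
  beyond `n = 2` (`lean search 'timeOrdered|amputat|schwingerFn'`: `Matrix.schwingerTwoPoint`,
  `FermionQuasiFreeTimeOrderedWick` (free, determinant form), `FKTFermiLiquidOverview.amputatedG₄`
  (continuum jellium overview)); integral operators on `L²`: `L2KernelOperator.kernelOp` (continuous
  compactly supported kernels on `ℝ`) and `PositiveKernelTransferOperator.exists_kernelOp` (real scalars,
  existence form) — hence the complex-scalar `boundedKernelOp` here, on the tree's
  `IntegralOperatorHilbertSchmidt.memLp_two_integral_kernel_mul`.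

## Sources

G. Benfatto, A. Giuliani, V. Mastropietro, Ann. Henri Poincaré 7 (2006) 809–898 (arXiv:cond-mat/0507686),
§1.2 (1.2)–(1.5) (Schwinger functions, time ordering, the two-point function and its transform), §2.1
(2.5), §2.4 (2.25) (the quartic kernel `W₄` in the field order `ψ⁺_σψ⁻_σψ⁺_{σ'}ψ⁻_{σ'}`), §2.5 (2.45)–(2.48)
and (2.57)–(2.58) (anisotropic and isotropic sectors), §2.7 (2.70)–(2.71), §2.8 (2.73), §3 (3.65)
[`BenfattoGiulianiMastropietro2006`]; S. Raghu, S. A. Kivelson, D. J. Scalapino, Phys. Rev. B 81 (2010)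
224505, §II (7) (the pairing vertex as an integral operator on the Fermi curve with measure `dk̂/v_F`),
§III (17) (the `D₄` channels) [`RaghuKivelsonScalapino2010`]; M. Salmhofer, Commun. Math. Phys. 194
(1998) 249, §2 (finite-temperature four-point functions and their regularity as the object of Fermi-liquid
criteria) [`Salmhofer1998`].
-/

noncomputable section

open MeasureTheory Filter Topology Finset
open scoped ENNReal
open Literature.Probability.LatticeModels

namespace Literature.MathematicalPhysics.QuantumLattice

/-! ## §1 Time-ordered `n`-point Schwinger functions of the Hubbard torus (finite volume) -/

section Schwinger

/-- A **leg** of an `n`-point Schwinger function of the Hubbard torus of side `L`: a charge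
(`0 ↦ a† = ψ⁺`, `1 ↦ a = ψ⁻`, the convention of `HubbardFieldIdx`), a torus site, a spin and an
imaginary time. [cite: BenfattoGiulianiMastropietro2006, §1.2 (1.2)] -/
structure SchwingerLeg (L : ℕ) where
  /-- charge: `0 ↦ a†_{x⃗σ}` (`ψ⁺`), `1 ↦ a_{x⃗σ}` (`ψ⁻`) -/
  charge : Fin 2
  /-- the site `x⃗ ∈ (ℤ/Lℤ)²` -/
  site : TorusSite 2 L
  /-- the spin `σ` -/
  spin : Fin 2
  /-- the imaginary time `x₀` -/
  time : ℝ

/-- The field operator `a^c_{x⃗σ}` on the Fock space of the fermionic torus: `c = 0` the creation,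
`c = 1` the annihilation operator (the Jordan–Wigner matrices `creation` / `annihilation` of the
tree). [folklore] -/
def hubbardFieldOp (L : ℕ) [NeZero L] (c : Fin 2) (x : TorusSite 2 L) (σ : Fin 2) :
    Matrix (Finset (Orb (FermionTorus 2 L))) (Finset (Orb (FermionTorus 2 L))) ℂ :=
  if c = 0 then creation (orb (FermionTorus.ofTorusSite x) σ)
  else annihilation (orb (FermionTorus.ofTorusSite x) σ)

/-- The imaginary-time evolved field `a^c_{x⃗σ}(x₀) = e^{x₀H} a^c_{x⃗σ} e^{-x₀H}` of a leg,
`H = hubbardTorusWith 2 L 1 U μ` (the tree's `Matrix.imagTimeEvolve`). [cite: BenfattoGiulianiMastropietro2006, §1.2 (1.2)] -/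
def schwingerLegOp (U μ : ℝ) (L : ℕ) [NeZero L] (ℓ : SchwingerLeg L) :
    Matrix (Finset (Orb (FermionTorus 2 L))) (Finset (Orb (FermionTorus 2 L))) ℂ :=
  Matrix.imagTimeEvolve (hubbardTorusWith 2 L 1 U μ) (ℓ.time : ℂ) (hubbardFieldOp L ℓ.charge ℓ.site ℓ.spin)

/-- **The time-ordering permutation**: `timeOrderPerm τ` lists the indices in order of DECREASING
time, `τ (timeOrderPerm τ 0) ≥ τ (timeOrderPerm τ 1) ≥ ⋯` — BGM (1.3): "`π` is a permutation of
`{1,…,n}`, chosen in such a way that `x_{π(1)0} ≥ ⋯ ≥ x_{π(n)0}`" (`Tuple.sort` followed by reversal;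
among EQUAL times the larger index comes first — BGM's footnote 1 puts creation operators first instead;
the two conventions differ on a null set of times and agree for the two-point function written as
`(a, a†)`, `schwingerFn_two`). [cite: BenfattoGiulianiMastropietro2006, §1.2 (1.3)] -/
def timeOrderPerm {n : ℕ} (τ : Fin n → ℝ) : Equiv.Perm (Fin n) :=
  Tuple.sort τ * Fin.revPerm

/-- `timeOrderPerm τ i = sort τ (rev i)`. [cite: BenfattoGiulianiMastropietro2006, §1.2 (1.3)] -/
theorem timeOrderPerm_apply {n : ℕ} (τ : Fin n → ℝ) (i : Fin n) :
    timeOrderPerm τ i = Tuple.sort τ (Fin.rev i) := rfl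

/-- The times along `timeOrderPerm τ` are non-increasing (the defining property of the time ordering
(1.3)). [cite: BenfattoGiulianiMastropietro2006, §1.2 (1.3)] -/
theorem antitone_comp_timeOrderPerm {n : ℕ} (τ : Fin n → ℝ) : Antitone (τ ∘ ⇑(timeOrderPerm τ)) := by
  intro i j hij
  simp only [Function.comp_apply, timeOrderPerm_apply]
  exact Tuple.monotone_sort τ (Fin.rev_le_rev.mpr hij)

/-- **The time-ordered product** `T[a^{c₀}_{ℓ₀}(τ₀) ⋯ a^{c_{n-1}}_{ℓ_{n-1}}(τ_{n-1})]`: the evolved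
fields multiplied in order of decreasing time, times the sign of the rearranging permutation
(fermionic time ordering). [cite: BenfattoGiulianiMastropietro2006, §1.2 (1.3)] -/
def timeOrderedProd (U μ : ℝ) (L : ℕ) [NeZero L] {n : ℕ} (ℓ : Fin n → SchwingerLeg L) :
    Matrix (Finset (Orb (FermionTorus 2 L))) (Finset (Orb (FermionTorus 2 L))) ℂ :=
  (((Equiv.Perm.sign (timeOrderPerm fun i => (ℓ i).time) : ℤˣ) : ℤ) : ℂ) •
    (List.ofFn fun i => schwingerLegOp U μ L (ℓ (timeOrderPerm (fun i => (ℓ i).time) i))).prod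

/-- **The finite-volume `n`-point Schwinger function** of the Hubbard torus at inverse temperature
`β`: `S(ℓ₀, …, ℓ_{n-1}) = ⟨T a^{c₀}_{x⃗₀σ₀}(x₀,₀) ⋯⟩_{β,L} = tr(e^{-βH} T[⋯]) / tr e^{-βH}`,
`H = hubbardTorusWith 2 L 1 U μ` (junk `0` for `L = 0`). For `n = 2` and legs `(a, a†)` it is the
tree's `Matrix.schwingerTwoPoint` (`schwingerFn_two`). [cite: BenfattoGiulianiMastropietro2006, §1.2 (1.2)] -/
def schwingerFn (β U μ : ℝ) (L : ℕ) {n : ℕ} (ℓ : Fin n → SchwingerLeg L) : ℂ :=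
  if hL : L = 0 then 0
  else
    haveI : NeZero L := ⟨hL⟩
    Matrix.gibbsState β (hubbardTorusWith 2 L 1 U μ) (timeOrderedProd U μ L ℓ)

/-- Junk value: at `L = 0` every Schwinger function is `0`. [cite: BenfattoGiulianiMastropietro2006, §1.2 (1.2)] -/
@[simp] theorem schwingerFn_size_zero (β U μ : ℝ) {n : ℕ} (ℓ : Fin n → SchwingerLeg 0) :
    schwingerFn β U μ 0 ℓ = 0 := by
  simp [schwingerFn]

/-- Unfolding for `L ≠ 0`: `S = ⟨T ⋯⟩_{β,L}`. [cite: BenfattoGiulianiMastropietro2006, §1.2 (1.2)] -/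
theorem schwingerFn_eq (β U μ : ℝ) (L : ℕ) [NeZero L] {n : ℕ} (ℓ : Fin n → SchwingerLeg L) :
    schwingerFn β U μ L ℓ = Matrix.gibbsState β (hubbardTorusWith 2 L 1 U μ) (timeOrderedProd U μ L ℓ) := by
  rw [schwingerFn, dif_neg (NeZero.ne L)]

/-- The permutations of `Fin 2`. [folklore] -/
private theorem perm_fin_two (σ : Equiv.Perm (Fin 2)) : σ = 1 ∨ σ = Equiv.swap 0 1 := by
  revert σ; decide

/-- `Fin.revPerm` on `Fin 2` is the transposition. [folklore] -/
private theorem revPerm_two : (Fin.revPerm : Equiv.Perm (Fin 2)) = Equiv.swap 0 1 := by decide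

/-- **Consistency with the tree's two-point Schwinger function**: for two legs, `schwingerFn` is
`Matrix.schwingerTwoPoint` of the two field operators (same fermionic sign, same equal-time
convention: the second operator to the left). [cite: BenfattoGiulianiMastropietro2006, §1.2 (1.2)–(1.3)] -/
theorem schwingerFn_two (β U μ : ℝ) (L : ℕ) [NeZero L] (ℓ ℓ' : SchwingerLeg L) :
    schwingerFn β U μ L ![ℓ, ℓ'] =
      Matrix.schwingerTwoPoint β (hubbardTorusWith 2 L 1 U μ) (hubbardFieldOp L ℓ.charge ℓ.site ℓ.spin)
        (hubbardFieldOp L ℓ'.charge ℓ'.site ℓ'.spin) ℓ.time ℓ'.time := by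
  rw [schwingerFn_eq, timeOrderedProd]
  set τ : Fin 2 → ℝ := fun i => (![ℓ, ℓ'] i).time with hτ
  have hτ0 : τ 0 = ℓ.time := rfl
  have hτ1 : τ 1 = ℓ'.time := rfl
  by_cases h : ℓ.time ≤ ℓ'.time
  · -- `τ` is monotone: `sort τ = 1`, the time order is `(1, 0)` with sign `-1`
    have hmono : Monotone τ := by
      intro i j hij
      fin_cases i <;> fin_cases j
      · exact le_rfl
      · exact h
      · exact absurd hij (by decide)
      · exact le_rfl
    have hsort : Tuple.sort τ = 1 := Tuple.sort_eq_refl_iff_monotone.mpr hmono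
    have hperm : timeOrderPerm τ = Equiv.swap 0 1 := by rw [timeOrderPerm, hsort, one_mul, revPerm_two]
    rw [Matrix.schwingerTwoPoint_of_le _ _ _ _ h]
    simp only [hperm, Equiv.Perm.sign_swap (show (0 : Fin 2) ≠ 1 by decide), Units.val_neg, Units.val_one,
      Int.cast_neg, Int.cast_one, List.ofFn_succ, List.ofFn_zero, List.prod_cons, List.prod_nil, mul_one,
      Equiv.swap_apply_left, Equiv.swap_apply_right, Fin.succ_zero_eq_one, Matrix.cons_val_one,
      Matrix.cons_val_zero, map_smul, smul_eq_mul, neg_mul, one_mul]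
    rfl
  · rw [not_le] at h
    have hnot : ¬ Monotone τ := fun hm => (hm (show (0 : Fin 2) ≤ 1 by decide)).not_gt h
    have hsort : Tuple.sort τ = Equiv.swap 0 1 := by
      rcases perm_fin_two (Tuple.sort τ) with h1 | h1
      · exact absurd (Tuple.sort_eq_refl_iff_monotone.mp h1) hnot
      · exact h1
    have hperm : timeOrderPerm τ = 1 := by
      rw [timeOrderPerm, hsort, revPerm_two, Equiv.swap_mul_self]
    rw [Matrix.schwingerTwoPoint_of_lt _ _ _ _ h]
    simp only [hperm, Equiv.Perm.sign_one, Units.val_one, Int.cast_one, List.ofFn_succ, List.ofFn_zero,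
      List.prod_cons, List.prod_nil, mul_one, Equiv.Perm.coe_one, id_eq, Fin.succ_zero_eq_one,
      Matrix.cons_val_one, Matrix.cons_val_zero, one_smul]
    rfl

/-- **Consistency with `hubbardSchwingerTwoPoint`**: the two-leg Schwinger function with legs
`(a_{x⃗σ}(x₀), a†_{y⃗σ'}(y₀))` is BGM's `S^{β,L}(𝐱,σ,-;𝐲,σ',+)` of `HubbardSchwingerFunction.lean` (sites of
`ℤ²` read modulo `L`). [cite: BenfattoGiulianiMastropietro2006, §1.2 (1.2)–(1.3)] -/
theorem schwingerFn_annihilation_creation (β U μ : ℝ) (L : ℕ) [NeZero L] (x₀ : ℝ) (x : Site 2) (σ : Fin 2)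
    (y₀ : ℝ) (y : Site 2) (σ' : Fin 2) :
    schwingerFn β U μ L ![⟨1, Torus.proj L x, σ, x₀⟩, ⟨0, Torus.proj L y, σ', y₀⟩] =
      hubbardSchwingerTwoPoint β U μ L x₀ x σ y₀ y σ' := by
  rw [schwingerFn_two, hubbardSchwingerTwoPoint_eq]
  simp [hubbardFieldOp]

/-- **The truncated (connected) four-point function**
`S₄ᵀ(ℓ₀,ℓ₁,ℓ₂,ℓ₃) = S₄ - (S₂(ℓ₀,ℓ₁)S₂(ℓ₂,ℓ₃) - S₂(ℓ₀,ℓ₂)S₂(ℓ₁,ℓ₃) + S₂(ℓ₀,ℓ₃)S₂(ℓ₁,ℓ₂))`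
(fermionic truncation; the one- and three-point functions vanish by particle-number symmetry of
`H`, so no further terms are subtracted). [cite: BenfattoGiulianiMastropietro2006, §1.2 (1.2)] -/
def schwingerFourT (β U μ : ℝ) (L : ℕ) (ℓ : Fin 4 → SchwingerLeg L) : ℂ :=
  schwingerFn β U μ L ℓ -
    (schwingerFn β U μ L ![ℓ 0, ℓ 1] * schwingerFn β U μ L ![ℓ 2, ℓ 3] -
      schwingerFn β U μ L ![ℓ 0, ℓ 2] * schwingerFn β U μ L ![ℓ 1, ℓ 3] +
      schwingerFn β U μ L ![ℓ 0, ℓ 3] * schwingerFn β U μ L ![ℓ 1, ℓ 2])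

end Schwinger

/-! ## §2 Momentum space, amputation and the Cooper kinematics -/

section MomentumSpace

/-- External data of a leg in frequency–momentum space: charge, spin, a frequency `k₀ ∈ ℝ` and a
CONTINUUM spatial momentum `k⃗ ∈ ℝ²` (lattice momenta `2πm⃗/L` and Fermi-curve points alike).
[cite: BenfattoGiulianiMastropietro2006, §1.2 (1.5)] -/
structure MomentumLeg where
  /-- charge: `0 ↦ ψ̂⁺`, `1 ↦ ψ̂⁻` -/
  charge : Fin 2
  /-- spin -/
  spin : Fin 2
  /-- Matsubara frequency `k₀` -/
  freq : ℝ
  /-- spatial momentum `k⃗ ∈ ℝ²` -/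
  mom : Momentum

/-- The plane wave `e^{-i s_c (k₀ x₀ + k⃗·x⃗)}` of a leg at the space-time point `(x₀, x⃗)` (sites read
through their representatives in `[0, L)`; `s_c = ±1` the tree's `chargeSign`; the sign convention of
`hubbardPlaneWave`, `ψ̂^±_k = ∫dx e^{∓ikx} ψ^±_x`). [cite: BenfattoGiulianiMastropietro2006, §2.1 (2.5)] -/
def legPhase (L : ℕ) (K : MomentumLeg) (x : TorusSite 2 L) (x₀ : ℝ) : ℂ :=
  Complex.exp (-((chargeSign K.charge * (K.freq * x₀ + ∑ i, K.mom i * ((x i).val : ℝ)) : ℝ) : ℂ) *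
    Complex.I)

/-- Plane waves are unimodular. [cite: BenfattoGiulianiMastropietro2006, §2.1 (2.5)] -/
theorem norm_legPhase (L : ℕ) (K : MomentumLeg) (x : TorusSite 2 L) (x₀ : ℝ) : ‖legPhase L K x x₀‖ = 1 := by
  rw [legPhase, ← Complex.ofReal_neg, Complex.norm_exp_ofReal_mul_I]

/-- **The momentum-space transform of an `n`-point function** `S` of legs (finite volume, intensive
normalisation): `Ŝ(K) = (βL²)⁻¹ ∫_{[0,β]^n} dx₀ Σ_{x⃗ ∈ Λ_L^n} ∏_i e^{-i s_{c_i} k_i·x_i} S((c_i, x⃗_i, σ_i, x₀,ᵢ)_i)`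
— the space-time Fourier sum divided by the one volume factor `βL²` that translation invariance
produces at conserving external momenta. [cite: BenfattoGiulianiMastropietro2006, §1.2 (1.5)] -/
def legTransform (β : ℝ) (L : ℕ) [NeZero L] {n : ℕ} (S : (Fin n → SchwingerLeg L) → ℂ)
    (K : Fin n → MomentumLeg) : ℂ :=
  ((β * (L : ℝ) ^ 2)⁻¹ : ℝ) *
    ∫ x₀ in Set.Icc (0 : Fin n → ℝ) (fun _ => β),
      ∑ x : Fin n → TorusSite 2 L,
        (∏ i, legPhase L (K i) (x i) (x₀ i)) * S (fun i => ⟨(K i).charge, x i, (K i).spin, x₀ i⟩)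

/-- The momentum-space `n`-point Schwinger function `Ŝ_n(K)`. [cite: BenfattoGiulianiMastropietro2006, §1.2 (1.5)] -/
def schwingerFnHat (β U μ : ℝ) (L : ℕ) [NeZero L] {n : ℕ} (K : Fin n → MomentumLeg) : ℂ :=
  legTransform β L (schwingerFn β U μ L) K

/-- The momentum-space TRUNCATED four-point function `Ŝ₄ᵀ(K)`. [cite: BenfattoGiulianiMastropietro2006, §1.2 (1.5)] -/
def schwingerFourTHat (β U μ : ℝ) (L : ℕ) [NeZero L] (K : Fin 4 → MomentumLeg) : ℂ :=
  legTransform β L (schwingerFourT β U μ L) K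

/-- **The interacting propagator of a leg**: the momentum-space two-point function
`Ŝ₂(k, σ) = (βL²)⁻¹ ∫∫ Σ_{x⃗,y⃗} e^{+ik·x} e^{-ik·y} ⟨T a_{x⃗σ}(x₀) a†_{y⃗σ}(y₀)⟩` at the leg's
frequency–momentum `k = (k₀, k⃗)` and spin — the transform of BGM's `S(x - y) = ⟨T ψ⁻_x ψ⁺_y⟩` (free
value `1/(-ik₀ + ε(k⃗) - μ)`); independent of the leg's charge. [cite: BenfattoGiulianiMastropietro2006, §1.2 (1.3)–(1.5)] -/
def propagatorHat (β U μ : ℝ) (L : ℕ) [NeZero L] (K : MomentumLeg) : ℂ :=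
  schwingerFnHat β U μ L ![⟨1, K.spin, K.freq, K.mom⟩, ⟨0, K.spin, K.freq, K.mom⟩]

/-- **The amputated connected four-point vertex** `Γ̂₄(K) = Ŝ₄ᵀ(K) / ∏_i Ŝ₂(k_i, σ_i)` (division
by the interacting propagators of the four external legs; junk `·/0 = 0`).
[cite: BenfattoGiulianiMastropietro2006, §1.2 (1.5)] -/
def amputatedFourHat (β U μ : ℝ) (L : ℕ) [NeZero L] (K : Fin 4 → MomentumLeg) : ℂ :=
  schwingerFourTHat β U μ L K / ∏ i, propagatorHat β U μ L (K i)

/-- **Cooper kinematics on the free Fermi curve.** The four legs in the field order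
`ψ⁺_{σ} ψ⁻_{σ} ψ⁺_{σ'} ψ⁻_{σ'}` of BGM (2.25) with `σ = ↑`, `σ' = ↓`: outgoing `ψ̂⁺_{k'↑}(ω)`, incoming
`ψ̂⁻_{k↑}(ω)`, outgoing `ψ̂⁺_{-k'↓}(-ω)`, incoming `ψ̂⁻_{-k↓}(-ω)`, `ω = π/β` the lowest fermionic
Matsubara frequency, `k = p_F(θ)`, `k' = p_F(θ')` points of the Fermi curve of
`ε = -2(cos k₁ + cos k₂)` at chemical potential `μ` (`fermiPolar μ`): incoming pair `(k, -k)`,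
outgoing pair `(k', -k')`, zero total momentum and frequency. [cite: BenfattoGiulianiMastropietro2006, §2.4 (2.25)] -/
def cooperLegs (β μ θ θ' : ℝ) : Fin 4 → MomentumLeg :=
  ![⟨0, 0, Real.pi / β, fermiPolar μ θ'⟩, ⟨1, 0, Real.pi / β, fermiPolar μ θ⟩,
    ⟨0, 1, -(Real.pi / β), -fermiPolar μ θ'⟩, ⟨1, 1, -(Real.pi / β), -fermiPolar μ θ⟩]

/-- **The finite-volume Cooper vertex** `hubbardCooperVertex β U μ L θ θ'` (the requested
`cooperVertex β U μ L θ θ'`; that name is taken by the Grassmann-side coefficient of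
`HubbardScaleReport.lean`): the amputated connected four-point vertex of `hubbardTorusWith 2 L 1 U μ`
at inverse temperature `β`, at the Cooper kinematics `(p_F(θ)↑, -p_F(θ)↓) → (p_F(θ')↑, -p_F(θ')↓)`
with external frequencies `±π/β` (junk `0` at `L = 0`). [cite: BenfattoGiulianiMastropietro2006, §1.2 (1.5), §2.4 (2.25)] -/
def hubbardCooperVertex (β U μ : ℝ) (L : ℕ) (θ θ' : ℝ) : ℂ :=
  if hL : L = 0 then 0
  else
    haveI : NeZero L := ⟨hL⟩
    amputatedFourHat β U μ L (cooperLegs β μ θ θ')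

/-- Junk value at `L = 0`. [cite: BenfattoGiulianiMastropietro2006, §1.2 (1.5)] -/
@[simp] theorem hubbardCooperVertex_size_zero (β U μ θ θ' : ℝ) : hubbardCooperVertex β U μ 0 θ θ' = 0 := by
  simp [hubbardCooperVertex]

/-- Unfolding for `L ≠ 0`: the vertex is the amputated truncated four-point function at the Cooper legs.
[cite: BenfattoGiulianiMastropietro2006, §1.2 (1.5)] -/
theorem hubbardCooperVertex_eq (β U μ : ℝ) (L : ℕ) [NeZero L] (θ θ' : ℝ) :
    hubbardCooperVertex β U μ L θ θ' = amputatedFourHat β U μ L (cooperLegs β μ θ θ') := by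
  rw [hubbardCooperVertex, dif_neg (NeZero.ne L)]

end MomentumSpace

/-! ## §3 The infinite-volume vertex as an integral operator on `L²(F_μ)` and its `D₄` blocks -/

/-! ### §3a Integral operators with bounded kernels on `L²` of a finite measure (complex scalars) -/

section KernelOp

variable {X : Type*} [MeasurableSpace X]

/-- The regularity under which the integral operator `(T_K φ)(x) = ∫ K(x, y) φ(y) dν(y)` is a bounded
(indeed Hilbert–Schmidt) operator on `L²(ν)` by the elementary `L¹ ≤ L²` estimate: `ν` finite, `K` jointly
(strongly) measurable and bounded — then `K ∈ L²(ν ⊗ ν)`, Reed–Simon's hypothesis.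
[cite: ReedSimonI1980, Thm. VI.23] -/
def IsBoundedKernelOn (ν : Measure X) (K : X → X → ℂ) : Prop :=
  IsFiniteMeasure ν ∧ StronglyMeasurable (Function.uncurry K) ∧ ∃ C : ℝ, ∀ x y, ‖K x y‖ ≤ C

/-- `‖φ‖_{L¹} ≤ ν(X)^{1/2} ‖φ‖_{L²}` on a finite measure space (Cauchy–Schwarz; the statement of
`Literature.NumberTheory.Automorphic.integral_norm_le_measure_univ_rpow_mul_norm`, re-proved here to
keep the import cone of this file inside `QuantumLattice`). [folklore] -/
private theorem integral_norm_le_rpow_mul_norm_Lp {ν : Measure X} [IsFiniteMeasure ν] (f : Lp ℂ 2 ν) :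
    ∫ x, ‖f x‖ ∂ν ≤ (ν Set.univ).toReal ^ (1 / 2 : ℝ) * ‖f‖ := by
  have h1 : eLpNorm f 1 ν ≤ eLpNorm f 2 ν * ν Set.univ ^ (1 / (1 : ℝ≥0∞).toReal - 1 / (2 : ℝ≥0∞).toReal) :=
    eLpNorm_le_eLpNorm_mul_rpow_measure_univ (by norm_num) (Lp.aestronglyMeasurable f)
  have hexp : (1 / (1 : ℝ≥0∞).toReal - 1 / (2 : ℝ≥0∞).toReal : ℝ) = 1 / 2 := by norm_num
  rw [hexp] at h1
  have hint : ∫ x, ‖f x‖ ∂ν = (eLpNorm f 1 ν).toReal := by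
    rw [integral_norm_eq_lintegral_enorm (Lp.aestronglyMeasurable f), eLpNorm_one_eq_lintegral_enorm]
  have h2 : (eLpNorm f 2 ν).toReal = ‖f‖ := (Lp.norm_def f).symm
  rw [hint, ← h2, mul_comm]
  have hfin : eLpNorm f 2 ν * ν Set.univ ^ (1 / 2 : ℝ) ≠ ∞ :=
    ENNReal.mul_ne_top (Lp.eLpNorm_ne_top f)
      (ENNReal.rpow_ne_top_of_nonneg (by norm_num) (measure_ne_top ν _))
  have := ENNReal.toReal_mono hfin h1
  rwa [ENNReal.toReal_mul, ← ENNReal.toReal_rpow] at this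

/-- `y ↦ K(x, y) φ(y)` is integrable for a bounded measurable kernel and `φ ∈ L²(ν)`, `ν` finite. [folklore] -/
private theorem integrable_kernel_mul_Lp {ν : Measure X} {K : X → X → ℂ} (h : IsBoundedKernelOn ν K)
    (φ : Lp ℂ 2 ν) (x : X) :
    Integrable (fun y => K x y * φ y) ν := by
  haveI := h.1
  obtain ⟨C, hC⟩ := h.2.2
  exact ((Lp.memLp φ).integrable one_le_two).bdd_mul (h.2.1.of_uncurry_left (x := x)).aestronglyMeasurable
    (Eventually.of_forall fun y => hC x y)

/-- The linear map `φ ↦ [x ↦ ∫ K(x,y) φ(y) dν(y)] ∈ L²` of a bounded kernel. [folklore] -/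
private def boundedKernelOpLin {ν : Measure X} {K : X → X → ℂ} (h : IsBoundedKernelOn ν K) :
    Lp ℂ 2 ν →ₗ[ℂ] Lp ℂ 2 ν :=
  haveI := h.1
  have hmem : ∀ φ : Lp ℂ 2 ν, MemLp (fun x => ∫ y, K x y * φ y ∂ν) 2 ν := fun φ =>
    Literature.Analysis.OperatorTheory.memLp_two_integral_kernel_mul h.2.1 (Classical.choose_spec h.2.2) φ
  { toFun := fun φ => (hmem φ).toLp _
    map_add' := fun φ ψ => by
      rw [← MemLp.toLp_add (hmem φ) (hmem ψ), MemLp.toLp_eq_toLp_iff]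
      refine Eventually.of_forall fun x => ?_
      change ∫ y, K x y * (φ + ψ : Lp ℂ 2 ν) y ∂ν = ∫ y, K x y * φ y ∂ν + ∫ y, K x y * ψ y ∂ν
      rw [← integral_add (integrable_kernel_mul_Lp h φ x) (integrable_kernel_mul_Lp h ψ x)]
      refine integral_congr_ae ?_
      filter_upwards [Lp.coeFn_add φ ψ] with y hy
      rw [hy, Pi.add_apply, mul_add]
    map_smul' := fun c φ => by
      rw [RingHom.id_apply, ← MemLp.toLp_const_smul, MemLp.toLp_eq_toLp_iff]
      refine Eventually.of_forall fun x => ?_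
      change ∫ y, K x y * (c • φ : Lp ℂ 2 ν) y ∂ν = c • ∫ y, K x y * φ y ∂ν
      rw [smul_eq_mul, ← integral_const_mul]
      refine integral_congr_ae ?_
      filter_upwards [Lp.coeFn_smul c φ] with y hy
      rw [hy, Pi.smul_apply, smul_eq_mul]
      ring }

/-- The a.e. kernel formula for `boundedKernelOpLin`. [folklore] -/
private theorem boundedKernelOpLin_coeFn {ν : Measure X} {K : X → X → ℂ} (h : IsBoundedKernelOn ν K)
    (φ : Lp ℂ 2 ν) :
    (boundedKernelOpLin h φ : X → ℂ) =ᵐ[ν] fun x => ∫ y, K x y * φ y ∂ν := by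
  haveI := h.1
  exact (Literature.Analysis.OperatorTheory.memLp_two_integral_kernel_mul h.2.1
    (Classical.choose_spec h.2.2) φ).coeFn_toLp

/-- The `L²` operator bound `‖T_K φ‖ ≤ ν(X)^{1/2} · |C| ν(X)^{1/2} · ‖φ‖`. [folklore] -/
private theorem exists_bound_boundedKernelOpLin {ν : Measure X} {K : X → X → ℂ} (h : IsBoundedKernelOn ν K) :
    ∃ M : ℝ, ∀ φ : Lp ℂ 2 ν, ‖boundedKernelOpLin h φ‖ ≤ M * ‖φ‖ := by
  haveI := h.1
  set C := Classical.choose h.2.2 with hCdef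
  have hC : ∀ x y, ‖K x y‖ ≤ C := Classical.choose_spec h.2.2
  set C' := max C 0 with hC'def
  have hC' : ∀ x y, ‖K x y‖ ≤ C' := fun x y => (hC x y).trans (le_max_left _ _)
  have hC'0 : 0 ≤ C' := le_max_right _ _
  refine ⟨(measureUnivNNReal ν : ℝ) ^ (2 : ℝ≥0∞).toReal⁻¹ * (C' * (ν Set.univ).toReal ^ (1 / 2 : ℝ)), fun φ => ?_⟩
  have h1 : ∀ᵐ x ∂ν, ‖(boundedKernelOpLin h φ : X → ℂ) x‖ ≤ C' * (ν Set.univ).toReal ^ (1 / 2 : ℝ) * ‖φ‖ := by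
    filter_upwards [boundedKernelOpLin_coeFn h φ] with x hx
    rw [hx]
    refine (Literature.Analysis.OperatorTheory.norm_integral_kernel_mul_le hC' φ x).trans ?_
    rw [mul_assoc]
    exact mul_le_mul_of_nonneg_left (integral_norm_le_rpow_mul_norm_Lp φ) hC'0
  have h2 := Lp.norm_le_of_ae_bound (by positivity) h1
  calc ‖boundedKernelOpLin h φ‖
      ≤ (measureUnivNNReal ν : ℝ) ^ (2 : ℝ≥0∞).toReal⁻¹ * (C' * (ν Set.univ).toReal ^ (1 / 2 : ℝ) * ‖φ‖) := h2
    _ = _ := by ring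

open Classical in
/-- **The integral operator of a kernel on `L²(ν)`**: `(T_K φ)(x) = ∫ K(x, y) φ(y) dν(y)` as a bounded
operator when `IsBoundedKernelOn ν K` (finite measure, bounded jointly measurable kernel), and the
junk value `0` otherwise (the operator is determined by the a.e. kernel formula, `boundedKernelOp_coeFn`;
it is the Hilbert–Schmidt operator of Reed–Simon Thm. VI.23, `K ∈ L²(ν ⊗ ν)`). [cite: ReedSimonI1980, Thm. VI.23] -/
def boundedKernelOp (ν : Measure X) (K : X → X → ℂ) : Lp ℂ 2 ν →L[ℂ] Lp ℂ 2 ν :=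
  if h : IsBoundedKernelOn ν K then
    (boundedKernelOpLin h).mkContinuousOfExistsBound (exists_bound_boundedKernelOpLin h)
  else 0

/-- **The kernel formula**: `(T_K φ)(x) = ∫ K(x, y) φ(y) dν(y)` for `ν`-a.e. `x`. [cite: ReedSimonI1980, Thm. VI.23] -/
theorem boundedKernelOp_coeFn {ν : Measure X} {K : X → X → ℂ} (h : IsBoundedKernelOn ν K) (φ : Lp ℂ 2 ν) :
    (boundedKernelOp ν K φ : X → ℂ) =ᵐ[ν] fun x => ∫ y, K x y * φ y ∂ν := by
  classical
  rw [boundedKernelOp, dif_pos h, LinearMap.mkContinuousOfExistsBound_apply]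
  exact boundedKernelOpLin_coeFn h φ

/-- Outside the regularity class the operator is the junk value `0`. [cite: ReedSimonI1980, Thm. VI.23] -/
theorem boundedKernelOp_of_not {ν : Measure X} {K : X → X → ℂ} (h : ¬ IsBoundedKernelOn ν K) :
    boundedKernelOp ν K = 0 := by
  classical
  rw [boundedKernelOp, dif_neg h]

end KernelOp

/-! ### §3b The `L → ∞` Cooper vertex, its kernel on the Fermi curve, the channel spaces and blocks -/

section Blocks

/-- **The infinite-volume Cooper vertex** `Γ_∞(θ, θ') = lim_{L → ∞} hubbardCooperVertex β U μ L θ θ'`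
(`limUnder`, junk where the limit does not exist; existence is the separate Prop
`HubbardCooperVertexLimitExists`). [cite: BenfattoGiulianiMastropietro2006, §1.2 (1.5)] -/
def hubbardCooperVertexLimit (β U μ θ θ' : ℝ) : ℂ :=
  limUnder atTop fun L : ℕ => hubbardCooperVertex β U μ L θ θ'

/-- **Existence of the infinite-volume Cooper vertex** at every pair of Fermi angles. [cite: BenfattoGiulianiMastropietro2006, §1.2 (1.5)] -/
def HubbardCooperVertexLimitExists (β U μ : ℝ) : Prop :=
  ∀ θ θ' : ℝ, ∃ v : ℂ, Tendsto (fun L : ℕ => hubbardCooperVertex β U μ L θ θ') atTop (𝓝 v)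

/-- Under existence, the finite-volume vertices converge to `hubbardCooperVertexLimit`. [cite: BenfattoGiulianiMastropietro2006, §1.2 (1.5)] -/
theorem tendsto_hubbardCooperVertexLimit {β U μ : ℝ} (h : HubbardCooperVertexLimitExists β U μ) (θ θ' : ℝ) :
    Tendsto (fun L : ℕ => hubbardCooperVertex β U μ L θ θ') atTop (𝓝 (hubbardCooperVertexLimit β U μ θ θ')) := by
  obtain ⟨v, hv⟩ := h θ θ'
  exact tendsto_nhds_limUnder ⟨v, hv⟩

/-- The polar angle `θ(k⃗) ∈ (-π, π]` of a momentum (as in `KohnLuttingerRadialProjection`: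
`fermiPolar μ (θ(k⃗))` is the radial projection of `k⃗ ≠ 0` to the Fermi curve). [cite: BenfattoGiulianiMastropietro2006, §1.2 (1.5)] -/
def momentumArg (k : Momentum) : ℝ := Complex.arg ⟨k 0, k 1⟩

/-- **The Cooper vertex as a kernel on the Fermi curve**: `K(k⃗_out, k⃗_in) = Γ_∞(θ(k⃗_in), θ(k⃗_out))`,
read through the polar angles (on `F_μ = {ε = μ}`, `-4 < μ < 0`, `k⃗ = fermiPolar μ (θ(k⃗))`). The
integral operator `(T ψ)(k⃗') = ∫_{F_μ} K(k⃗', k⃗) ψ(k⃗) dμ_F(k⃗)` with `dμ_F = ds/|∇ε|`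
(`fermiCurveMeasure`) is `hubbardCooperVertexOp`. [cite: RaghuKivelsonScalapino2010, §II (7)] -/
def hubbardCooperVertexKernel (β U μ : ℝ) (k' k : Momentum) : ℂ :=
  hubbardCooperVertexLimit β U μ (momentumArg k) (momentumArg k')

/-- **The Cooper vertex as a bounded operator on `L²(F_μ, ds/|∇ε|)`** (`F_μ` the Fermi curve of
`ε = squareDispersion 1 0` at chemical potential `μ`, measure `fermiCurveMeasure`): the integral
operator of `hubbardCooperVertexKernel β U μ` (junk `0` unless the kernel is bounded and jointly
measurable, `boundedKernelOp`; `μ_F` is finite for `-4 < μ < 0`, `isFiniteMeasure_fermiCurveMeasure`).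
[cite: RaghuKivelsonScalapino2010, §II (7)] -/
def hubbardCooperVertexOp (β U μ : ℝ) :
    Lp ℂ 2 (fermiCurveMeasure (squareDispersion 1 0) μ) →L[ℂ] Lp ℂ 2 (fermiCurveMeasure (squareDispersion 1 0) μ) :=
  boundedKernelOp (fermiCurveMeasure (squareDispersion 1 0) μ) (hubbardCooperVertexKernel β U μ)

/-- The kernel formula for the Cooper-vertex operator in its regularity class:
`(Tψ)(k⃗') = ∫ K(k⃗', k⃗) ψ(k⃗) dμ_F(k⃗)` a.e. [cite: RaghuKivelsonScalapino2010, §II (7)] -/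
theorem hubbardCooperVertexOp_coeFn {β U μ : ℝ}
    (h : IsBoundedKernelOn (fermiCurveMeasure (squareDispersion 1 0) μ) (hubbardCooperVertexKernel β U μ))
    (ψ : Lp ℂ 2 (fermiCurveMeasure (squareDispersion 1 0) μ)) :
    (hubbardCooperVertexOp β U μ ψ : Momentum → ℂ) =ᵐ[fermiCurveMeasure (squareDispersion 1 0) μ]
      fun k' => ∫ k, hubbardCooperVertexKernel β U μ k' k * ψ k ∂fermiCurveMeasure (squareDispersion 1 0) μ :=
  boundedKernelOp_coeFn h ψ

/-- A complex-valued function on momentum space **transforms in the irrep `χ` of `D₄`** iff its real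
and imaginary parts do (`InChannel`, the isotypic projection `d4Project` of `KohnLuttinger.lean`).
[cite: RaghuKivelsonScalapino2010, §III (17)] -/
def InChannelC (χ : D4Irrep) (ψ : Momentum → ℂ) : Prop :=
  InChannel χ (fun k => (ψ k).re) ∧ InChannel χ (fun k => (ψ k).im)

/-- **The `χ`-channel subspace of `L²(F_μ)`**: the closed span of the `L²` classes of
square-integrable functions transforming in the irrep `χ ∈ {A₁g, A₂g, B₁g, B₂g, E}` of `D₄` (for
`ε = squareDispersion 1 0`, `-4 < μ < 0` it contains the normalised channel states of
`KohnLuttingerChannelStates`, `exists_isChannelState`). [cite: RaghuKivelsonScalapino2010, §III (17)] -/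
def channelL2 (ε : Momentum → ℝ) (μ : ℝ) (χ : D4Irrep) : Submodule ℂ (Lp ℂ 2 (fermiCurveMeasure ε μ)) :=
  (Submodule.span ℂ {f : Lp ℂ 2 (fermiCurveMeasure ε μ) |
      ∃ ψ : Momentum → ℂ, InChannelC χ ψ ∧ ∃ hψ : MemLp ψ 2 (fermiCurveMeasure ε μ), f = hψ.toLp ψ}).topologicalClosure

/-- The channel subspaces are closed. [cite: RaghuKivelsonScalapino2010, §III (17)] -/
theorem isClosed_channelL2 (ε : Momentum → ℝ) (μ : ℝ) (χ : D4Irrep) :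
    IsClosed (channelL2 ε μ χ : Set (Lp ℂ 2 (fermiCurveMeasure ε μ))) :=
  Submodule.isClosed_topologicalClosure _

/-- The channel subspaces are complete (Hilbert spaces in their own right). [cite: RaghuKivelsonScalapino2010, §III (17)] -/
theorem completeSpace_channelL2 (ε : Momentum → ℝ) (μ : ℝ) (χ : D4Irrep) : CompleteSpace (channelL2 ε μ χ) :=
  (isClosed_channelL2 ε μ χ).completeSpace_coe

/-- **The `D₄` block `V_Γ` of the Cooper vertex** (the requested `cooperVertexBlock β U μ Γ`): the
compression `P_Γ T P_Γ` of the Cooper-vertex operator `T = hubbardCooperVertexOp β U μ` to the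
`Γ`-channel subspace of `L²(F_μ, ds/|∇ε|)`, `Γ ∈ {A₁g, A₂g, B₁g, B₂g, E}`, as a bounded operator on
that Hilbert space (`P_Γ` the orthogonal projection). [cite: RaghuKivelsonScalapino2010, §II (7), §III (17)] -/
def hubbardCooperVertexBlock (β U μ : ℝ) (χ : D4Irrep) :
    channelL2 (squareDispersion 1 0) μ χ →L[ℂ] channelL2 (squareDispersion 1 0) μ χ :=
  haveI : CompleteSpace (channelL2 (squareDispersion 1 0) μ χ) := completeSpace_channelL2 _ μ χ
  (channelL2 (squareDispersion 1 0) μ χ).orthogonalProjectionOnto ∘L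
    (hubbardCooperVertexOp β U μ ∘L (channelL2 (squareDispersion 1 0) μ χ).subtypeL)

end Blocks

/-! ## §4 The scale-resolved quartic kernels of the effective action in isotropic sectors -/

section IsoSectors

variable (L M : ℕ) [NeZero L]

/-- **The two-index sector multipliers** on the renormalised band `e` (scale index `n`, i.e.
`h = -n`, `γ = 4`; angular index `m`): `F_{n,m,ω}(k) = C_h⁻¹(√(k₀² + e(k⃗)²)) · ζ_{m,ω}(θ(k⃗))` with
`C_h⁻¹ = gnScaleCutoff 4 e₀ h` the cutoff of the fields of scales `≤ h` and `ζ_{m,ω} = sectorWeightCirc m ω`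
the angular partition of unity with `sectorCount m = 2^{m+1}` sectors of width `π/2^m` centred at
`sectorCenter m ω`; `m = n` gives the anisotropic multipliers `bgmMultiplier` ((2.45)–(2.48), width
`γ^{h/2}`), `m = 2n` the ISOTROPIC ones ((2.57), width `πγ^{h}`) — the lattice-momentum analogue of
`sectorCutoffGen` of `IsotropicSectors.lean`. [cite: BenfattoGiulianiMastropietro2006, §2.5 (2.45), (2.57)] -/
def sectorMultiplierGen (e₀ β : ℝ) (e : TorusSite 2 L → ℝ) (n m : ℕ) (ω : Fin (sectorCount m)) (k : FreqMomentum L M) : ℂ :=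
  ((gnScaleCutoff 4 e₀ (-(n : ℤ)) (Real.sqrt (matsubaraFreq β M k.1 ^ 2 + e k.2 ^ 2)) *
      sectorWeightCirc m ω (momentumAngle L k.2) : ℝ) : ℂ)

omit [NeZero L] in
/-- The anisotropic case `m = n` is `bgmMultiplier` ((2.45)–(2.48)). [cite: BenfattoGiulianiMastropietro2006, §2.5 (2.45)] -/
theorem sectorMultiplierGen_self (e₀ β : ℝ) (e : TorusSite 2 L → ℝ) (n : ℕ) :
    sectorMultiplierGen L M e₀ β e n n = bgmMultiplier L M e₀ β e n := rfl

/-- **The isotropic sector multipliers at scale `h = -n`**: angular index `2n`, i.e.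
`sectorCount (2n) = 2·4ⁿ` sectors of width `π 4^{-n} = πγ^h` ((2.57): `F̄_{h,ω̄} = C_h⁻¹ ζ̄_{h,ω̄}` for
the external fields of scales `≤ h`). [cite: BenfattoGiulianiMastropietro2006, §2.5 (2.57)–(2.58)] -/
def isoMultiplier (e₀ β : ℝ) (e : TorusSite 2 L → ℝ) (n : ℕ) :
    Fin (sectorCount (2 * n)) → FreqMomentum L M → ℂ :=
  sectorMultiplierGen L M e₀ β e n (2 * n)

variable {L M}

omit [NeZero L] in
/-- The multipliers are real numbers in `[0, 1]` (cutoff functions times a partition of unity). [cite: BenfattoGiulianiMastropietro2006, §2.5 (2.45), (2.57)] -/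
theorem sectorMultiplierGen_mem (e₀ β : ℝ) (e : TorusSite 2 L → ℝ) (n m : ℕ) (ω : Fin (sectorCount m))
    (k : FreqMomentum L M) :
    ∃ r : ℝ, r ∈ Set.Icc (0 : ℝ) 1 ∧ sectorMultiplierGen L M e₀ β e n m ω k = r :=
  ⟨_, ⟨mul_nonneg (gnScaleCutoff_mem_Icc _ _ _ _).1 (sectorWeightCirc_nonneg _ _ _),
    mul_le_one₀ (gnScaleCutoff_mem_Icc _ _ _ _).2 (sectorWeightCirc_nonneg _ _ _) (sectorWeightCirc_le_one _ _ _)⟩, rfl⟩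

omit [NeZero L] in
/-- `|F_{n,m,ω}(k)| ≤ 1`. [cite: BenfattoGiulianiMastropietro2006, §2.5 (2.45), (2.57)] -/
theorem norm_sectorMultiplierGen_le_one (e₀ β : ℝ) (e : TorusSite 2 L → ℝ) (n m : ℕ) (ω : Fin (sectorCount m))
    (k : FreqMomentum L M) : ‖sectorMultiplierGen L M e₀ β e n m ω k‖ ≤ 1 := by
  obtain ⟨r, hr, h⟩ := sectorMultiplierGen_mem e₀ β e n m ω k
  rw [h, Complex.norm_real, Real.norm_eq_abs, abs_of_nonneg hr.1]
  exact hr.2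

omit [NeZero L] in
/-- **Partition of unity**: for every angular index the multipliers sum to the cutoff of the fields of
scales `≤ h`, `Σ_{ω} F_{n,m,ω}(k) = C_h⁻¹(√(k₀² + e(k⃗)²))`. [cite: BenfattoGiulianiMastropietro2006, §2.5 (2.45), (2.57)] -/
theorem sum_sectorMultiplierGen (e₀ β : ℝ) (e : TorusSite 2 L → ℝ) (n m : ℕ) (k : FreqMomentum L M) :
    ∑ ω : Fin (sectorCount m), sectorMultiplierGen L M e₀ β e n m ω k =
      ((gnScaleCutoff 4 e₀ (-(n : ℤ)) (Real.sqrt (matsubaraFreq β M k.1 ^ 2 + e k.2 ^ 2)) : ℝ) : ℂ) := by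
  simp only [sectorMultiplierGen, Complex.ofReal_mul, ← mul_sum]
  rw [← Complex.ofReal_sum, Fin.sum_univ_eq_sum_range (fun i => sectorWeightCirc m (i : ℤ) (momentumAngle L k.2)),
    show (∑ i ∈ range (sectorCount m), sectorWeightCirc m ((i : ℕ) : ℤ) (momentumAngle L k.2)) = 1 from
      sum_sectorWeightCirc_eq_one m _, Complex.ofReal_one, mul_one]

omit [NeZero L] in
/-- The isotropic multipliers sum to the cutoff of the fields of scales `≤ h`. [cite: BenfattoGiulianiMastropietro2006, §2.5 (2.57)] -/
theorem sum_isoMultiplier (e₀ β : ℝ) (e : TorusSite 2 L → ℝ) (n : ℕ) (k : FreqMomentum L M) :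
    ∑ ω : Fin (sectorCount (2 * n)), isoMultiplier L M e₀ β e n ω k =
      ((gnScaleCutoff 4 e₀ (-(n : ℤ)) (Real.sqrt (matsubaraFreq β M k.1 ^ 2 + e k.2 ^ 2)) : ℝ) : ℂ) :=
  sum_sectorMultiplierGen e₀ β e n (2 * n) k

omit [NeZero L] in
/-- `|F̄_{h,ω̄}(k)| ≤ 1`. [cite: BenfattoGiulianiMastropietro2006, §2.5 (2.57)] -/
theorem norm_isoMultiplier_le_one (e₀ β : ℝ) (e : TorusSite 2 L → ℝ) (n : ℕ) (ω : Fin (sectorCount (2 * n)))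
    (k : FreqMomentum L M) : ‖isoMultiplier L M e₀ β e n ω k‖ ≤ 1 :=
  norm_sectorMultiplierGen_le_one e₀ β e n (2 * n) ω k

variable (L M)

/-- The discrete leg labels of a quartic sector 4-tuple `Ω = (ω₁, ω₂, ω₃, ω₄)` in the field order
`ψ⁺_{x₁σ} ψ⁻_{x₂σ} ψ⁺_{x₃σ'} ψ⁻_{x₄σ'}` of BGM (2.25): charges `(+, -, +, -)`, spins `(σ, σ, σ', σ')`.
[cite: BenfattoGiulianiMastropietro2006, §2.4 (2.25)] -/
def quarticSectorLegs {N : ℕ} (σ σ' : Fin 2) (Ω : Fin 4 → Fin N) : Fin 4 → SectorLeg N :=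
  ![((Ω 0, σ), 0), ((Ω 1, σ), 1), ((Ω 2, σ'), 0), ((Ω 3, σ'), 1)]

/-- **The sectorised position-space quartic kernels** `W_{4,Ω}(x₁, …, x₄)` of a Grassmann polynomial
`G` for a family of sector multipliers `F` and a sector 4-tuple `Ω` in the field order (2.25)
(`sectorisedKernel` of `SectorisedKernelNorm.lean` in degree `4`: leg `i` carries
`F_{ω_i}(k_i) e^{-is_{c_i}k_i·x_i}`). [cite: BenfattoGiulianiMastropietro2006, §2.7 (2.70)–(2.71)] -/
def quarticKernelSectors {N : ℕ} (β : ℝ) (F : Fin N → FreqMomentum L M → ℂ) (G : HubbardGrassmann L M)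
    (σ σ' : Fin 2) (Ω : Fin 4 → Fin N) (x : Fin 4 → SpaceTimeIdx L M) : ℂ :=
  sectorisedKernel L M β F G 4 (quarticSectorLegs σ σ' Ω) x

/-- **The quartic kernel of the scale-`h` effective action in ISOTROPIC sectors** (the requested
`quarticKernelIsoSectors`): for `G = hubbardEffectiveActionCT L M β U μ h_seed K Λ` (the effective
action in the counterterm frame `K`, `HubbardEffectiveActionCT.lean`) at scale index `n` (`h = -n`),
the position-space kernels `λ̃_{h,Ω̄}(x₁,…,x₄)` of its quartic part with the four external legs
refined to the isotropic sectors `Ω̄ ∈ Ō_h⁴`, `|Ō_h| = sectorCount (2n) = 2·4ⁿ`, on the renormalised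
band `e_K = nambuXiCT L μ K`, in the field order (2.25) with spins `(σ, σ, σ', σ')`. These are the
kernels over which an inductive hypothesis on scales is stated in the sectorised `L¹–L^∞` norms
(`hubbardSectorKernelNorm` with the multipliers `isoMultiplier`). [cite: BenfattoGiulianiMastropietro2006, §2.5 (2.57), §2.7 (2.70)–(2.71), §3 (3.65)] -/
def quarticKernelIsoSectors (β U μ hs : ℝ) (K : TrigPolyC4v) (Λ e₀ : ℝ) (n : ℕ) (σ σ' : Fin 2)
    (Ω : Fin 4 → Fin (sectorCount (2 * n))) (x : Fin 4 → SpaceTimeIdx L M) : ℂ :=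
  quarticKernelSectors L M β (isoMultiplier L M e₀ β (nambuXiCT L μ K) n)
    (hubbardEffectiveActionCT L M β U μ hs K Λ) σ σ' Ω x

/-- **The singlet quartic coupling function** of `G` at four lattice frequency–momenta in the field
order (2.25) with `σ = ↑`, `σ' = ↓`: `λ(p₁, p₂, p₃, p₄) = (βL²)³ ×` the coefficient of
`ψ̂⁺_{p₁↑} ψ̂⁻_{p₂↑} ψ̂⁺_{p₃↓} ψ̂⁻_{p₄↓}` in `G` — the tree's reduced singlet Cooper vertex
`cooperVertex L M β G k₁ k₂ k₃ k₄` (coefficient of `ψ⁺_{k₁↑}ψ⁺_{k₂↓}ψ⁻_{k₄↓}ψ⁻_{k₃↑}`, `HubbardScaleReport.lean`)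
at `(k₁, k₂, k₃, k₄) = (p₁, p₃, p₂, p₄)` (an even rearrangement of the fields; the normalisation
`(βL²)³` undoes the three volume factors of a local quartic monomial, BGM (2.6a)). [cite: BenfattoGiulianiMastropietro2006, §2.4 (2.25)] -/
def singletCoupling (β : ℝ) (G : HubbardGrassmann L M) (p : Fin 4 → FreqMomentum L M) : ℂ :=
  cooperVertex L M β G (p 0) (p 2) (p 1) (p 3)

omit [NeZero L] in
/-- The zero polynomial has zero singlet coupling. [cite: BenfattoGiulianiMastropietro2006, §2.4 (2.25)] -/
@[simp] theorem singletCoupling_zero (β : ℝ) (p : Fin 4 → FreqMomentum L M) :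
    singletCoupling L M β 0 p = 0 := by
  simp [singletCoupling, cooperVertex_zero_right]

open Classical in
/-- **The sector phase-space weight** of a 4-tuple `Ω` for the multipliers `F`: the `F`-weighted number
of CONSERVING lattice 4-tuples `(p₁, p₂, p₃, p₄)` (created pair label `p₁ + p₃` = annihilated pair
label `p₂ + p₄`, `pairLabel`) in the four sector supports. It vanishes iff the 4-tuple is not
admissible (cf. `bgmSectorSet`). [cite: BenfattoGiulianiMastropietro2006, §2.8 (2.73)] -/
def sectorWeight4 {N : ℕ} (F : Fin N → FreqMomentum L M → ℂ) (Ω : Fin 4 → Fin N) : ℂ :=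
  ∑ p : Fin 4 → FreqMomentum L M,
    if pairLabel L M (p 0) (p 2) = pairLabel L M (p 1) (p 3) then ∏ i, F (Ω i) (p i) else 0

/-- **The sector-averaged singlet coupling** of `G` on the 4-tuple `Ω`: the `F`-weighted average of the
singlet coupling function over the lattice 4-tuples in the four sector supports,
`V(Ω) = (Σ_p ∏_i F_{ω_i}(p_i) λ(p)) / sectorWeight4 F Ω` (junk `·/0 = 0` on inadmissible 4-tuples).
[cite: BenfattoGiulianiMastropietro2006, §2.7 (2.70)–(2.71)] -/
def singletCouplingSectors {N : ℕ} (β : ℝ) (F : Fin N → FreqMomentum L M → ℂ) (G : HubbardGrassmann L M)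
    (Ω : Fin 4 → Fin N) : ℂ :=
  (∑ p : Fin 4 → FreqMomentum L M, (∏ i, F (Ω i) (p i)) * singletCoupling L M β G p) / sectorWeight4 L M F Ω

/-- The zero polynomial has zero sector-averaged couplings. [cite: BenfattoGiulianiMastropietro2006, §2.7 (2.70)–(2.71)] -/
@[simp] theorem singletCouplingSectors_zero {N : ℕ} (β : ℝ) (F : Fin N → FreqMomentum L M → ℂ)
    (Ω : Fin 4 → Fin N) : singletCouplingSectors L M β F 0 Ω = 0 := by
  simp [singletCouplingSectors]

/-- **The scale-`h` singlet Cooper array in isotropic sectors** `V_h : Ō_h⁴ → ℂ`: the sector-averaged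
singlet coupling of `hubbardEffectiveActionCT L M β U μ h_seed K Λ` over the ISOTROPIC sectors at
scale index `n` — the array `(Fin n_h)⁴ → ℂ`, `n_h = sectorCount (2n)`, over which the Cooper /
non-Cooper split by the particle–particle transfer `ppTransfer` and the `D₄`-block flow are stated
(at Cooper 4-tuples its `(ω̄₁, ω̄₃ | ω̄₂, ω̄₄)` sub-arrays are the kernels `V_h(q; θ̄_out, θ̄_in)`).
[cite: BenfattoGiulianiMastropietro2006, §2.5 (2.57), §3 (3.65)] -/
def singletCouplingIsoSectors (β U μ hs : ℝ) (K : TrigPolyC4v) (Λ e₀ : ℝ) (n : ℕ)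
    (Ω : Fin 4 → Fin (sectorCount (2 * n))) : ℂ :=
  singletCouplingSectors L M β (isoMultiplier L M e₀ β (nambuXiCT L μ K) n)
    (hubbardEffectiveActionCT L M β U μ hs K Λ) Ω

variable {L M}

/-! ### Transfer momenta of a sector 4-tuple -/

/-- **The Fermi point of an isotropic sector** at scale index `n`: `p_F(θ̄_{h,ω̄})`, the point of the free
Fermi curve of `ε = -2(cos k₁ + cos k₂)` at chemical potential `μ` at the sector centre
`θ̄ = (ω̄ + ½) π 4^{-n}` ((2.58): `k⃗ = p_F(θ̄_{h,ω̄}) + O(γ^h)` on the sector support).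
[cite: BenfattoGiulianiMastropietro2006, §2.5 (2.58)] -/
def isoSectorFermiPoint (μ : ℝ) (n : ℕ) (ω : Fin (sectorCount (2 * n))) : Momentum :=
  fermiPolar μ (sectorCenter (2 * n) ω)

/-- Reduction of a momentum to the centred Brillouin zone `(-π, π]²` (representative modulo `2πℤ²`; momenta
of the lattice model live in `𝒟_L ⊂ (-π, π]²`, BGM (1.4)(b)). [cite: BenfattoGiulianiMastropietro2006, §1.2 (1.4)] -/
def torusReduce (q : Momentum) : Momentum :=
  WithLp.toLp 2 fun i => toIocMod Real.two_pi_pos (-Real.pi) (q i)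

/-- The distance `|q|_𝕋` of a momentum to the reciprocal lattice `2πℤ²` (Euclidean norm of its centred
representative). [cite: BenfattoGiulianiMastropietro2006, §1.2 (1.4)] -/
def reciprocalLatticeDist (q : Momentum) : ℝ := ‖torusReduce q‖

/-- **The particle–particle transfer momentum** of a sector 4-tuple (field order (2.25)):
`q = p_F(θ̄_{ω̄₂}) + p_F(θ̄_{ω̄₄})`, the total momentum of the incoming (annihilated) pair, equal modulo
`2πℤ²` and up to `O(γ^h)` to that of the outgoing pair; the Cooper class at scale `h` is
`|q|_𝕋 ≲ γ^h`. [cite: BenfattoGiulianiMastropietro2006, §2.4 (2.25)] -/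
def ppTransfer (μ : ℝ) (n : ℕ) (Ω : Fin 4 → Fin (sectorCount (2 * n))) : Momentum :=
  isoSectorFermiPoint μ n (Ω 1) + isoSectorFermiPoint μ n (Ω 3)

/-- **The direct particle–hole transfer** `Q_d = p_F(θ̄_{ω̄₁}) - p_F(θ̄_{ω̄₂})`. [cite: BenfattoGiulianiMastropietro2006, §2.4 (2.25)] -/
def phTransferDirect (μ : ℝ) (n : ℕ) (Ω : Fin 4 → Fin (sectorCount (2 * n))) : Momentum :=
  isoSectorFermiPoint μ n (Ω 0) - isoSectorFermiPoint μ n (Ω 1)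

/-- **The exchange particle–hole transfer** `Q_x = p_F(θ̄_{ω̄₁}) - p_F(θ̄_{ω̄₄})`. [cite: BenfattoGiulianiMastropietro2006, §2.4 (2.25)] -/
def phTransferExchange (μ : ℝ) (n : ℕ) (Ω : Fin 4 → Fin (sectorCount (2 * n))) : Momentum :=
  isoSectorFermiPoint μ n (Ω 0) - isoSectorFermiPoint μ n (Ω 3)

open Classical in
/-- **The scale of a transfer**: `t = min(0, ⌊log_γ r⌋) ∈ ℤ_{≤ 0}` for `r = |q|_𝕋 > 0`, and `⊥ = -∞`
for `r = 0` (`γ` the scale ratio, `4` in this tree; the momentum-scale index `h ≤ 0` of the multiscale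
decomposition: `|{-ik₀} + E_h(k⃗) - μ| ≈ γ^h` on the support of the single-scale cutoff `f_h` of (2.28)). [cite: BenfattoGiulianiMastropietro2006, §2.3 (2.27)–(2.28)] -/
def transferScale (γ r : ℝ) : WithBot ℤ :=
  if r = 0 then ⊥ else ((min 0 ⌊Real.logb γ r⌋ : ℤ) : WithBot ℤ)

/-- The particle–particle transfer scale `t(Ω)` of a sector 4-tuple (`γ = 4`). [cite: BenfattoGiulianiMastropietro2006, §2.3 (2.27)–(2.28)] -/
def ppTransferScale (μ : ℝ) (n : ℕ) (Ω : Fin 4 → Fin (sectorCount (2 * n))) : WithBot ℤ :=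
  transferScale 4 (reciprocalLatticeDist (ppTransfer μ n Ω))

/-- Zero transfer has scale `-∞`. [cite: BenfattoGiulianiMastropietro2006, §2.3 (2.27)–(2.28)] -/
@[simp] theorem transferScale_zero (γ : ℝ) : transferScale γ 0 = ⊥ := by
  simp [transferScale]

/-- A transfer of size `≥ 1` has scale `0`. [cite: BenfattoGiulianiMastropietro2006, §2.3 (2.27)–(2.28)] -/
theorem transferScale_of_one_le {γ r : ℝ} (hγ : 1 < γ) (hr : 1 ≤ r) : transferScale γ r = ((0 : ℤ) : WithBot ℤ) := by
  have hr0 : r ≠ 0 := by positivity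
  rw [transferScale, if_neg hr0, min_eq_left]
  exact Int.floor_nonneg.mpr (Real.logb_nonneg hγ hr)

end IsoSectors

end Literature.MathematicalPhysics.QuantumLattice

end
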